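import Summits.QuantumFields.BalabanUV.T4Continuum.Spine.NE2BalabanFlatWitness

/-!
# NE2PertLawsTopLevel — F-TOP ONE FLOOR DOWN: at a `1`-PADDED tower row NE2's UN-WINDOWED H-cons letter `PerturbationLaws.consistent_le : ∀ k`
# compares the top-level perturbation with ZERO (registry fact F-TOP′, substrate-typer (π9-3), `HOME/CLAIMS.log` l.23757)

Cell `pub-balaban`, unit `b2b-balaban-t4-ne5-formalise-leaf-10` (NE5 formalisation swarm leaf 10, gen 15; LOCATED TYPING POINT F-ne5leaf10g15-1 =
`HOME/GAPS.md` § G-ne5leaf10g15-1, journal l.23735; filed on the substrate-typer's GO (π9-3) riders (g1)–(g4)).  Sibling of substrate-p3's F-TOP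
certificate (`substrate/p3/xread/CertHlocTopLevel.rc0.lean` 17740b1b6fd41526; typer (π5), l.23503: row NE2's binder `hloc : LocalRate … ∀ k` at a
`towerOf`-padded tower forces the finest field within `O(L^{−2K})` of `1`).  Summits-side NEW WORK ([folklore] kernel bookkeeping on OUR typed
objects; 0 def, 0 `[cite:]`); imports `Spine/NE2BalabanFlatWitness` ONLY.  HONEST: a kernel-certified VACUITY of OUR un-windowed letter at OUR padded
towers; NOT an objection to [Balaban1985BackgroundPropagators] ∕ [Balaban1987RG1] ∕ [King1986] or to any printed statement; nothing proved about
Bałaban's fields or minimisers; no landed theorem is false; no label ∕ count ∕ status moves; NE5 ∕ NE2 NOT PRINTED ∕ NOT PROVED; spine PROVED 0∕9;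
rung (B)+1 finite T⁴ — NOT infinite volume, NOT mass gap, NOT Clay.  HONEST DEPENDENCY (cell, verbatim): continuum YM on T⁴ ⇐ BetaPertH ∧ nine spine
estimates (0/9 proved); BetaPertH ⇐ (D1) ∧ (D4) ∧ CAP+tail; G-an2-4 gates asym, D1 and NE2/3/4.

WHAT (kernel facts only).
* §1 `consistent_top_of_vanish` — for ANY `PerturbationLaws D P J κ e₂` and a level with `P (K+1) = 0`, H-cons at `k = K` READS
  `‖D_{K+1}⁻¹ · (J_K · P_K) · D_K⁻¹‖ ≤ e₂ K`: the level-`K` perturbation, sandwiched by the free propagators and the injection, compared with ZERO.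
* §2 `balabanPert_apply_eq_zero_of_level` — Bałaban's typed tier-B perturbation of record `P_B = balabanPert (liftR Rg) (gaugeSlot Rg (QuT (siteT Rg))
  Q1 a′)` is LEVEL-LOCAL in the site-based transporters and VANISHES at every level with `Rg k = 1` (`covPertC`, `avgPert`∕`QcovLev`, `gaugeP`∕`Sop`∕
  `QuT`∕`siteT` read `Rg k` only; flat values `covLapC_one`, `avgPert_trivial`, `siteTr_one` + `siteMul_one` — the one-level form of `balabanPert_flat`).
* §3 `sandwich_top_le_of_perturbationLaws_padded(_rate)` — at a `1`-PADDED tower (`hpad : ∀ k, K < k → Rg k = 1`, DISPLAYED; discharged at the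
  substrate's `towerOfS` by `SubstrateAvgTowerPlumbing.towerOfS_of_lt` at the call site) ANY un-windowed `PerturbationLaws (Δ_a ⊗ 1) P_B (J ⊗ 1) κ e₂`
  FORCES `‖(Δ_a^{(K+1)} ⊗ 1)⁻¹ · ((J_K ⊗ 1) · P_B K) · (Δ_a^{(K)} ⊗ 1)⁻¹‖ ≤ e₂ K` (`= C₂·θ^K` on the rate road) — the junk-level artefact of the
  un-windowed `∀ k`, one floor below F-TOP: the window `{k | k + 1 ≤ K}` has to be threaded through H-cons, not through `LocalRate` alone.
0 sorry; axioms ⊆ {propext, Classical.choice, Quot.sound}.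
-/

noncomputable section

open scoped BigOperators ComplexConjugate Matrix Matrix.Norms.L2Operator Kronecker

namespace Summit.QuantumFields.BalabanUV.T4Continuum.NE2PertLawsTopLevel

open Literature.MathematicalPhysics.QuantumFieldTheory.Balaban1983to89.B5Prop11Plancherel
open Literature.MathematicalPhysics.QuantumFieldTheory.Balaban1983to89.B5G183RateUnitTower (lev lev_neZero)
open Summit.QuantumFields.BalabanUV.T4Continuum
open Summit.QuantumFields.BalabanUV.T4Continuum.BalabanAveragedTowerUnit (idx)
open Summit.QuantumFields.BalabanUV.T4Continuum.BackgroundResolventTower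
open Summit.QuantumFields.BalabanUV.T4Continuum.KingPairingPlantedLaw
open Summit.QuantumFields.BalabanUV.T4Continuum.BlockMultiplication (siteMul siteMul_one)
open Summit.QuantumFields.BalabanUV.T4Continuum.ColourCovariantLaplacian (covLapC lapC covPertC)
open Summit.QuantumFields.BalabanUV.T4Continuum.CovariantBlockAveraging (QcovLev)
open Summit.QuantumFields.BalabanUV.T4Continuum.GaugeTermPerturbationLaw (oneR gaugeTerm)
open Summit.QuantumFields.BalabanUV.T4Continuum.GaugeTermLayer (gaugeP Gop Sop)
open Summit.QuantumFields.BalabanUV.T4Continuum.GaugeTermScalarData (QuT Q1)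
open Summit.QuantumFields.BalabanUV.T4Continuum.RegularSiteTransporters (siteT siteTr siteTr_one)
open Summit.QuantumFields.BalabanUV.T4Continuum.NE2BalabanLayer (tierBPert)
open Summit.QuantumFields.BalabanUV.T4Continuum.NE2BalabanRoot (avgPert avgPert_trivial balabanPert)
open Summit.QuantumFields.BalabanUV.T4Continuum.NE2BalabanGauge (gaugeSlot liftR liftR_apply)
open Summit.QuantumFields.BalabanUV.T4Continuum.NE2BalabanFlatWitness (covLapC_one)

/-! ## §1 H-cons at a level above which the perturbation vanishes -/

section Abstract

variable {ι : ℕ → Type*} [∀ k, Fintype (ι k)] [∀ k, DecidableEq (ι k)]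
variable {D P : (k : ℕ) → Matrix (ι k) (ι k) ℂ} {J : (k : ℕ) → Matrix (ι (k + 1)) (ι k) ℂ} {κ : ℝ} {e₂ : ℕ → ℝ}

/-- [folklore] **H-cons ABOVE A VANISHING LEVEL COMPARES THE PERTURBATION WITH ZERO**: if `P (K+1) = 0`, the consistency letter of
`PerturbationLaws` at `k = K` reads `‖D_{K+1}⁻¹ · J_K · P_K · D_K⁻¹‖ ≤ e₂ K`. -/
theorem consistent_top_of_vanish (h : PerturbationLaws D P J κ e₂) {K : ℕ} (hP : P (K + 1) = 0) :
    ‖(D (K + 1))⁻¹ * (J K * P K) * (D K)⁻¹‖ ≤ e₂ K := by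
  have hc := h.consistent_le K
  rwa [hP, Matrix.zero_mul, zero_sub, Matrix.mul_neg, Matrix.neg_mul, norm_neg] at hc

end Abstract

/-! ## §2 Bałaban's typed tier-B perturbation is level-local and vanishes at an identity level -/

section Balaban

variable {d : ℕ} (L : ℕ) [NeZero L] (M : Fin d → ℕ) [hM : ∀ μ, NeZero (M μ)] (a : ℝ) (ha : 0 < a)
variable {o : Type*} [Fintype o] [DecidableEq o]
variable {Rg : (k : ℕ) → Fin d → (Tor (fine (lev L k) M) → Matrix o o ℂ)} {k : ℕ}

omit [NeZero L] hM [Fintype o] in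
/-- [folklore] the lift is level-local: `Rg k = 1 ⟹ liftR Rg k = 1`. -/
theorem liftR_apply_eq_one_of_level (hk : Rg k = fun _ _ => 1) : liftR L M Rg k = fun _ _ => 1 := by
  funext ν i
  rw [liftR_apply, hk]

/-- [folklore] the covariant-Laplacian summand is level-local and vanishes at an identity level: `Rg k = 1 ⟹ (Δ^{R_k} − Δ ⊗ 1) = 0`. -/
theorem covPertC_eq_zero_of_level (hk : Rg k = fun _ _ => 1) : covPertC L M (liftR L M Rg) k = 0 := by
  rw [covPertC, liftR_apply_eq_one_of_level L M hk, sub_eq_zero]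
  exact covLapC_one (fine (lev L k) M) ((lev L k : ℕ) : ℂ)

omit [NeZero L] in
/-- [folklore] the covariant-averaging summand is level-local and vanishes at an identity level. -/
theorem avgPert_eq_zero_of_level (hk : Rg k = fun _ _ => 1) : avgPert L M a (liftR L M Rg) k = 0 := by
  have h : avgPert L M a (liftR L M Rg) k = avgPert L M a (fun _ _ _ => (1 : Matrix o o ℂ)) k := by
    simp only [avgPert, QcovLev, liftR_apply_eq_one_of_level L M hk]
  rw [h]
  exact avgPert_trivial L M a k

/-- [folklore] the transported scalar averaging is level-local and is the free one at an identity level: `Rg k = 1 ⟹ Q′(U_k) = Q′_1,k`. -/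
theorem QuT_siteT_eq_Q1_of_level (hk : Rg k = fun _ _ => 1) : QuT L M o (siteT L M Rg) k = Q1 L M o k := by
  have hs : siteT L M Rg k = fun _ => (1 : Matrix o o ℂ) := by
    funext x
    rw [siteT, hk]
    exact siteTr_one (lev L k) M x
  rw [QuT, hs, siteMul_one, Matrix.mul_one, Q1]

/-- [folklore] the gauge slot is level-local and vanishes at an identity level: `Rg k = 1 ⟹ P₄,k = 0`. -/
theorem gaugeSlot_eq_zero_of_level (a' : ℝ) (hk : Rg k = fun _ _ => 1) :
    gaugeSlot L M Rg (QuT L M o (siteT L M Rg)) (Q1 L M o) a' k = 0 := by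
  have hQ := QuT_siteT_eq_Q1_of_level L M (o := o) hk
  have hP : gaugeP L M Rg (QuT L M o (siteT L M Rg)) a' k = gaugeP L M (oneR L M (o := o)) (Q1 L M o) a' k := by
    simp only [gaugeP, Gop, Sop, hk, hQ]
  rw [gaugeSlot, gaugeTerm, hP, sub_self, neg_zero]

/-- [folklore] **`Rg k = 1 ⟹ P_B k = 0`** — Bałaban's typed tier-B perturbation of record (rows B2 + B3 + B4) is LEVEL-LOCAL in the site-based
transporters and VANISHES at every identity level (the one-level form of `NE2BalabanFlatWitness.balabanPert_flat`). -/
theorem balabanPert_apply_eq_zero_of_level (a' : ℝ) (hk : Rg k = fun _ _ => 1) :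
    balabanPert L M a (liftR L M Rg) (gaugeSlot L M Rg (QuT L M o (siteT L M Rg)) (Q1 L M o) a') k = 0 := by
  rw [balabanPert, tierBPert, covPertC_eq_zero_of_level L M hk, avgPert_eq_zero_of_level L M a hk,
    gaugeSlot_eq_zero_of_level L M a' hk, add_zero, add_zero]

/-! ## §3 At a `1`-padded tower the un-windowed H-cons compares the top perturbation with zero -/

/-- [folklore] **F-TOP ONE FLOOR DOWN — ROW NE2's H-cons LETTER AT A PADDED TOWER** (`hpad`: `Rg k = 1` for `K < k`, the substrate's `towerOfS`):
ANY un-windowed `PerturbationLaws (Δ_a ⊗ 1) P_B (J ⊗ 1) κ e₂` forces `‖(Δ_a^{(K+1)} ⊗ 1)⁻¹·((J_K ⊗ 1)·P_B K)·(Δ_a^{(K)} ⊗ 1)⁻¹‖ ≤ e₂ K` — the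
level-`K` perturbation (finest connection `w_K`, K-uniform size letter) compared with ZERO; junk-level artefact of the un-windowed `∀ k`. -/
theorem sandwich_top_le_of_perturbationLaws_padded (a' : ℝ) {K : ℕ} (hpad : ∀ k, K < k → Rg k = fun _ _ => 1) {κ : ℝ} {e₂ : ℕ → ℝ}
    (h : PerturbationLaws (fun k => calDalev L M a ha k ⊗ₖ (1 : Matrix o o ℂ))
      (balabanPert L M a (liftR L M Rg) (gaugeSlot L M Rg (QuT L M o (siteT L M Rg)) (Q1 L M o) a'))
      (fun k => JpcT L M k ⊗ₖ (1 : Matrix o o ℂ)) κ e₂) :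
    ‖(calDalev L M a ha (K + 1) ⊗ₖ (1 : Matrix o o ℂ))⁻¹
        * (JpcT L M K ⊗ₖ (1 : Matrix o o ℂ)
          * balabanPert L M a (liftR L M Rg) (gaugeSlot L M Rg (QuT L M o (siteT L M Rg)) (Q1 L M o) a') K)
        * (calDalev L M a ha K ⊗ₖ (1 : Matrix o o ℂ))⁻¹‖ ≤ e₂ K :=
  consistent_top_of_vanish h (balabanPert_apply_eq_zero_of_level L M a a' (hpad (K + 1) (Nat.lt_succ_self K)))

/-- [folklore] the rate-road instance: with `e₂ k = C₂·θ^k` the top sandwich is `≤ C₂·θ^K`. -/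
theorem sandwich_top_le_of_perturbationLaws_padded_rate (a' : ℝ) {K : ℕ} (hpad : ∀ k, K < k → Rg k = fun _ _ => 1) {κ C₂ θ : ℝ}
    (h : PerturbationLaws (fun k => calDalev L M a ha k ⊗ₖ (1 : Matrix o o ℂ))
      (balabanPert L M a (liftR L M Rg) (gaugeSlot L M Rg (QuT L M o (siteT L M Rg)) (Q1 L M o) a'))
      (fun k => JpcT L M k ⊗ₖ (1 : Matrix o o ℂ)) κ (fun k => C₂ * θ ^ k)) :
    ‖(calDalev L M a ha (K + 1) ⊗ₖ (1 : Matrix o o ℂ))⁻¹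
        * (JpcT L M K ⊗ₖ (1 : Matrix o o ℂ)
          * balabanPert L M a (liftR L M Rg) (gaugeSlot L M Rg (QuT L M o (siteT L M Rg)) (Q1 L M o) a') K)
        * (calDalev L M a ha K ⊗ₖ (1 : Matrix o o ℂ))⁻¹‖ ≤ C₂ * θ ^ K :=
  sandwich_top_le_of_perturbationLaws_padded L M a ha a' hpad h

end Balaban

end Summit.QuantumFields.BalabanUV.T4Continuum.NE2PertLawsTopLevel

end
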